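import Mathlib
import Literature.LinearAlgebra.Matrix.PerronSymmetric
import HarnessLib

/-!
# Newman's modularity and modularity matrix

HONEST FRAMING: instance-level adjudication of specific advantage claims; no claim about
BQP vs BPP or the summit.

The objective maximised by every "community detection on a quantum annealer / by QAOA /
by quantum-inspired dynamics" row of the register is Newman–Girvan modularity.  Sources
(verbatim, held texts `paper:arxiv-physics_0605087` and `paper:arxiv-physics_0602124`):

[cite: Newman2006EigenvectorsPRE] M. E. J. Newman, *Finding community structure in networks
using the eigenvectors of matrices*, Phys. Rev. E 74, 036104 (2006) = arXiv:physics/0605087.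
* §3, eq. (q1): "Let us define `g_i` to be the community to which vertex `i` belongs. Then the
  modularity can be written `Q = (1/2m) ∑_{ij} [A_{ij} − P_{ij}] δ(g_i, g_j)`, where
  `δ(r,s) = 1` if `r = s` and `0` otherwise and `m` is again the number of edges";
  "it is axiomatically the case that `Q = 0` when all vertices are placed in a single group
  together … `∑_{ij} P_{ij} = ∑_{ij} A_{ij} = 2m`" (eq. (sanity)); "`∑_j P_{ij} = k_i`"
  (eq. (constraint)); "`P_{ij} = k_i k_j / 2m`" (eq. (defscm)).
* §4.1: "`δ(g_i,g_j) = ½(s_i s_j + 1)`. Thus we can write (q1) in the form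
  `Q = (1/4m) ∑_{ij} [A_{ij} − P_{ij}](s_i s_j + 1) = (1/4m) ∑_{ij} [A_{ij} − P_{ij}] s_i s_j`
  … `Q = (1/4m) sᵀBs` (q2), where `B` is the real symmetric matrix having elements
  `B_{ij} = A_{ij} − P_{ij}`. We call this matrix the modularity matrix"; "all rows (and
  columns) of the modularity matrix sum to zero: `∑_j B_{ij} = ∑_j A_{ij} − ∑_j P_{ij}
  = k_i − k_i = 0`. This immediately implies that for any network the vector `(1,1,1,…)` is an
  eigenvector of the modularity matrix with eigenvalue zero"; eq. (q3):
  "`Q = (1/4m) ∑_i a_i² β_i`, where `β_i` is the eigenvalue of `B` corresponding to the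
  eigenvector `u_i`".
* §4.2: with the `n × c` index matrix `S_{ij} = 1` if vertex `i` belongs to community `j`, `0`
  otherwise, "`δ(g_i,g_j) = ∑_{k=1}^{c} S_{ik} S_{jk}`" and
  "`∑_{i,j=1}^{n} ∑_{k=1}^{c} B_{ij} S_{ik} S_{jk} = Tr(SᵀBS)`".

[cite: Newman2006ModularityPNAS] M. E. J. Newman, *Modularity and community structure in
networks*, PNAS 103, 8577–8582 (2006) = arXiv:physics/0602124, eqs. (1)–(3): the same
`Q = (1/4m) sᵀBs`, `B_{ij} = A_{ij} − k_i k_j/2m`, and "writing `s` as a linear combination of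
the normalized eigenvectors `u_i` of `B` … `Q = (1/4m) ∑_i a_i² β_i`" with `∑_i a_i² = n`.

Rendering: `G : SimpleGraph V` on a finite vertex type (simple graphs: `A_{ij} ∈ {0,1}`, no
multi-edges), `A = G.adjMatrix ℝ` (Mathlib), `k_i = G.degree i`, `m = #G.edgeFinset`; the null
model `P_{ij} = k_i k_j/(2m)` and `B = A − P` as real matrices; `modularity G g` for a community
assignment `g : V → α` is eq. (q1) with the configuration-model `P`.  Division by `2m` is
Lean's total division (for the edgeless graph all of `k`, `P`, `B`, `Q` are `0`, and every
identity below still holds).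

What is here (all proved; 0 named facts):
* `sum_adjMatrix_row` (`∑_j A_{ij} = k_i`), `sum_degVec` (`∑_i k_i = 2m`),
  **`sum_nullModel_row`** (eq. (constraint) `∑_j P_{ij} = k_i`), **`sum_nullModel`** and
  `sum_adjMatrix` (eq. (sanity) `∑_{ij} P_{ij} = ∑_{ij} A_{ij} = 2m`);
* **`sum_modularityMatrix_row`** (rows of `B` sum to zero), `isSymm_modularityMatrix`,
  **`modularityMatrix_mulVec_one`** (`B·(1,…,1) = 0`: the printed eigenvector with eigenvalue
  zero), **`modularity_const`** ("`Q = 0` when all vertices are placed in a single group");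
* two groups: `delta_eq_spin` (`δ(g_i,g_j) = ½(s_i s_j + 1)`) and **`modularity_eq_quadForm`**
  (eq. (q2): `Q = sᵀBs/(4m)` for the `±1` vector `s` of a two-colouring `g : V → Bool`);
* `c` groups: `delta_eq_sum_indexMatrix` (`δ(g_i,g_j) = ∑_k S_{ik}S_{jk}`) and
  **`modularity_eq_trace`** (`Q = Tr(SᵀBS)/(2m)`);
* **`modularity_le_card_mul_topEigenvalue`** — the Rayleigh bound implicit in eq. (q3) with
  `∑_i a_i² = sᵀs = n`: for every two-colouring, `Q ≤ n β₁/(4m)`, `β₁` the largest eigenvalue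
  of `B` (the tree's `Literature.LinearAlgebra.Matrix.topEigenvalue` / `dotProduct_mulVec_le`).
  This is stated as a consequence proved here; the papers use (q3) to motivate the
  leading-eigenvector heuristic rather than print the inequality.

NOT here: the leading-eigenvector algorithm and its quality, the generalised modularity matrix
`B^{(g)}` for repeated bisection, resolution-limit or `Q ∈ [−½, 1)` statements, weighted or
multi-graphs.
-/

namespace Literature.Combinatorics.SimpleGraph.NewmanModularity

open Matrix Finset Literature.LinearAlgebra.Matrix

variable {V : Type*} [Fintype V] (G : SimpleGraph V) [DecidableRel G.Adj]

/-! ## §1 Degrees, edge count, the null model and the modularity matrix -/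

/-- The degree vector `k_i` (as reals). [cite: Newman2006EigenvectorsPRE, §3 eq. (degree)] -/
def degVec : V → ℝ := fun i => (G.degree i : ℝ)

/-- The number of edges `m`. [cite: Newman2006EigenvectorsPRE, §3 ("m is again the number of
edges in the network")] -/
noncomputable def edgeNum : ℝ := (G.edgeFinset.card : ℝ)

/-- The configuration-model null model `P_{ij} = k_i k_j / 2m`.
[cite: Newman2006EigenvectorsPRE, §3 eq. (defscm)] -/
noncomputable def nullModel : Matrix V V ℝ := fun i j => degVec G i * degVec G j / (2 * edgeNum G)

/-- **The modularity matrix** `B_{ij} = A_{ij} − k_i k_j/2m`.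
[cite: Newman2006EigenvectorsPRE, §4.1 eq. (defb); Newman2006ModularityPNAS, eq. (3)] -/
noncomputable def modularityMatrix : Matrix V V ℝ := G.adjMatrix ℝ - nullModel G

/-- **Modularity** of a community assignment `g : V → α`:
`Q = (1/2m) ∑_{ij} [A_{ij} − P_{ij}] δ(g_i, g_j)`. [cite: Newman2006EigenvectorsPRE, §3 eq. (q1)
with eq. (defscm)] -/
noncomputable def modularity {α : Type*} [DecidableEq α] (g : V → α) : ℝ :=
  (∑ i, ∑ j, if g i = g j then modularityMatrix G i j else 0) / (2 * edgeNum G)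

/-- Unfolding: `B_{ij} = A_{ij} − k_i k_j / 2m`. [cite: Newman2006EigenvectorsPRE, §4.1 eq. (defb)
with eq. (defscm); Newman2006ModularityPNAS, eq. (3)] -/
theorem modularityMatrix_apply (i j : V) :
    modularityMatrix G i j = G.adjMatrix ℝ i j - degVec G i * degVec G j / (2 * edgeNum G) := rfl

/-! ## §2 Row sums: eqs. (degree), (constraint), (sanity) -/

/-- `∑_j A_{ij} = k_i`. [cite: Newman2006EigenvectorsPRE, §3 eq. (degree)] -/
theorem sum_adjMatrix_row (i : V) : ∑ j, G.adjMatrix ℝ i j = degVec G i := by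
  have h := G.adjMatrix_mulVec_apply (α := ℝ) i (fun _ => (1 : ℝ))
  simp only [mulVec, dotProduct, mul_one, sum_const, nsmul_eq_mul] at h
  rw [h]
  rfl

/-- `∑_i k_i = 2m`. [cite: Newman2006EigenvectorsPRE, §3 ("since ∑_i k_i = 2m")] -/
theorem sum_degVec : ∑ i, degVec G i = 2 * edgeNum G := by
  have h := G.sum_degrees_eq_twice_card_edges
  unfold degVec edgeNum
  exact_mod_cast h

/-- `∑_{ij} A_{ij} = 2m`. [cite: Newman2006EigenvectorsPRE, §3 eq. (sanity)] -/
theorem sum_adjMatrix : ∑ i, ∑ j, G.adjMatrix ℝ i j = 2 * edgeNum G := by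
  simp_rw [sum_adjMatrix_row]
  exact sum_degVec G

/-- In the edgeless case every degree vanishes (used to dispatch `m = 0`). [folklore] -/
private theorem degVec_eq_zero_of_edgeNum_eq_zero (h : edgeNum G = 0) (i : V) : degVec G i = 0 := by
  have hs : ∑ j, degVec G j = 0 := by rw [sum_degVec, h, mul_zero]
  have hnn : ∀ j ∈ (univ : Finset V), 0 ≤ degVec G j := fun j _ => Nat.cast_nonneg _
  exact (sum_eq_zero_iff_of_nonneg hnn).mp hs i (mem_univ i)

/-- **eq. (constraint)**: the null model has the network's expected degrees,
`∑_j P_{ij} = k_i`. [cite: Newman2006EigenvectorsPRE, §3 eqs. (constraint), (rgconst)] -/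
theorem sum_nullModel_row (i : V) : ∑ j, nullModel G i j = degVec G i := by
  unfold nullModel
  by_cases h : edgeNum G = 0
  · simp [h, degVec_eq_zero_of_edgeNum_eq_zero G h i]
  · rw [← sum_div, ← mul_sum, sum_degVec]
    field_simp

/-- **eq. (sanity)**: `∑_{ij} P_{ij} = 2m`. [cite: Newman2006EigenvectorsPRE, §3 eq. (sanity)] -/
theorem sum_nullModel : ∑ i, ∑ j, nullModel G i j = 2 * edgeNum G := by
  simp_rw [sum_nullModel_row]
  exact sum_degVec G

/-! ## §3 The modularity matrix: zero row sums, symmetry, the trivial eigenvector -/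

/-- **"All rows (and columns) of the modularity matrix sum to zero"**:
`∑_j B_{ij} = k_i − k_i = 0`. [cite: Newman2006EigenvectorsPRE, §4.1 (display after
eq. (defb)); Newman2006ModularityPNAS, text after eq. (3)] -/
theorem sum_modularityMatrix_row (i : V) : ∑ j, modularityMatrix G i j = 0 := by
  unfold modularityMatrix
  rw [show (∑ j, (G.adjMatrix ℝ - nullModel G) i j) = ∑ j, (G.adjMatrix ℝ i j - nullModel G i j)
    from rfl, sum_sub_distrib, sum_adjMatrix_row, sum_nullModel_row, sub_self]

/-- `∑_{ij} B_{ij} = 0`. [cite: Newman2006EigenvectorsPRE, §3 ("we find that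
∑_{ij} [A_{ij} − P_{ij}] = 0")] -/
theorem sum_modularityMatrix : ∑ i, ∑ j, modularityMatrix G i j = 0 := by
  simp [sum_modularityMatrix_row]

/-- `B` is "the real symmetric matrix having elements `B_{ij} = A_{ij} − P_{ij}`".
[cite: Newman2006EigenvectorsPRE, §4.1] -/
theorem isSymm_modularityMatrix : (modularityMatrix G).IsSymm := by
  unfold modularityMatrix nullModel
  refine Matrix.IsSymm.sub (G.isSymm_adjMatrix) ?_
  ext i j
  simp [transpose_apply, mul_comm]

/-- `B` is Hermitian (real symmetric), so Mathlib's spectral theory applies.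
[cite: Newman2006EigenvectorsPRE, §4.1] -/
theorem isHermitian_modularityMatrix : (modularityMatrix G).IsHermitian := by
  have h := isSymm_modularityMatrix G
  unfold Matrix.IsHermitian
  rw [conjTranspose_eq_transpose_of_trivial]
  exact h

/-- **"The vector `(1,1,1,…)` is an eigenvector of the modularity matrix with eigenvalue
zero."** [cite: Newman2006EigenvectorsPRE, §4.1; Newman2006ModularityPNAS, text after eq. (3)] -/
theorem modularityMatrix_mulVec_one : modularityMatrix G *ᵥ (fun _ => (1 : ℝ)) = 0 := by
  ext i
  simp only [mulVec, dotProduct, mul_one, Pi.zero_apply]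
  exact sum_modularityMatrix_row G i

/-- **"`Q = 0` when all vertices are placed in a single group together."**
[cite: Newman2006EigenvectorsPRE, §3 (text before eq. (sanity))] -/
theorem modularity_const {α : Type*} [DecidableEq α] (a : α) : modularity G (fun _ : V => a) = 0 := by
  unfold modularity
  simp [sum_modularityMatrix]

/-! ## §4 Two groups: `δ = ½(s_i s_j + 1)` and `Q = sᵀBs / 4m` -/

/-- The `±1` index vector of a division into two groups: `s_i = 1` if vertex `i` belongs to
group 1 and `s_i = −1` if it belongs to group 2. [cite: Newman2006EigenvectorsPRE, §2
eq. (defss); Newman2006ModularityPNAS, text before eq. (1)] -/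
def spin (g : V → Bool) : V → ℝ := fun i => if g i then 1 else -1

/-- `sᵀs = n`. [cite: Newman2006ModularityPNAS, text after eq. (3) ("∑_i a_i² = n")] -/
theorem spin_dotProduct_self (g : V → Bool) : spin g ⬝ᵥ spin g = Fintype.card V := by
  simp only [dotProduct, spin]
  rw [show (∑ i, (if g i then (1 : ℝ) else -1) * (if g i then (1 : ℝ) else -1)) = ∑ _i : V, (1 : ℝ)
    from sum_congr rfl fun i _ => by split_ifs <;> norm_num]
  simp

omit [Fintype V] in
/-- **`δ(g_i, g_j) = ½ (s_i s_j + 1)`**. [cite: Newman2006EigenvectorsPRE, §4.1 (first display)] -/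
theorem delta_eq_spin (g : V → Bool) (i j : V) :
    (if g i = g j then (1 : ℝ) else 0) = (spin g i * spin g j + 1) / 2 := by
  unfold spin
  cases g i <;> cases g j <;> norm_num

/-- **eq. (q2): `Q = (1/4m) sᵀ B s`** for a division into two groups.
[cite: Newman2006EigenvectorsPRE, §4.1 eq. (q2); Newman2006ModularityPNAS, eq. (1)] -/
theorem modularity_eq_quadForm (g : V → Bool) :
    modularity G g = spin g ⬝ᵥ (modularityMatrix G *ᵥ spin g) / (4 * edgeNum G) := by
  unfold modularity
  have hδ : ∀ i j, (if g i = g j then modularityMatrix G i j else 0)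
      = modularityMatrix G i j * ((spin g i * spin g j + 1) / 2) := by
    intro i j
    rw [← delta_eq_spin]
    split_ifs <;> simp
  simp_rw [hδ]
  have hsplit : ∑ i, ∑ j, modularityMatrix G i j * ((spin g i * spin g j + 1) / 2)
      = (∑ i, ∑ j, modularityMatrix G i j * (spin g i * spin g j)) / 2
        + (∑ i, ∑ j, modularityMatrix G i j) / 2 := by
    rw [sum_div, sum_div, ← sum_add_distrib]
    refine sum_congr rfl fun i _ => ?_
    rw [sum_div, sum_div, ← sum_add_distrib]
    refine sum_congr rfl fun j _ => ?_
    ring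
  rw [hsplit, sum_modularityMatrix, zero_div, add_zero]
  have hquad : spin g ⬝ᵥ (modularityMatrix G *ᵥ spin g)
      = ∑ i, ∑ j, modularityMatrix G i j * (spin g i * spin g j) := by
    simp only [dotProduct, mulVec, mul_sum]
    refine sum_congr rfl fun i _ => sum_congr rfl fun j _ => ?_
    ring
  rw [hquad]
  by_cases h : edgeNum G = 0
  · simp [h]
  · field_simp
    ring

/-! ## §5 `c` groups: the index matrix and `Q = Tr(SᵀBS) / 2m` -/

/-- The `n × c` index matrix: `S_{ij} = 1` if vertex `i` belongs to community `j`, `0`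
otherwise. [cite: Newman2006EigenvectorsPRE, §4.2 eq. (defs01)] -/
def indexMatrix {α : Type*} [DecidableEq α] (g : V → α) : Matrix V α ℝ :=
  fun i k => if g i = k then 1 else 0

omit [Fintype V] in
/-- **`δ(g_i, g_j) = ∑_k S_{ik} S_{jk}`**. [cite: Newman2006EigenvectorsPRE, §4.2
(display before eq. (q4))] -/
theorem delta_eq_sum_indexMatrix {α : Type*} [Fintype α] [DecidableEq α] (g : V → α) (i j : V) :
    (if g i = g j then (1 : ℝ) else 0) = ∑ k, indexMatrix g i k * indexMatrix g j k := by
  unfold indexMatrix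
  simp only [ite_mul, one_mul, zero_mul]
  rw [sum_ite_eq]
  simp only [mem_univ, if_true]
  by_cases h : g i = g j
  · simp [h]
  · rw [if_neg h, if_neg (Ne.symm h)]

omit [DecidableRel G.Adj] in
/-- `Tr(Sᵀ B S) = ∑_{ij} B_{ij} ∑_k S_{ik} S_{jk}` for real matrices. [folklore] -/
private theorem trace_transpose_mul_mul {α : Type*} [Fintype α] (S : Matrix V α ℝ)
    (B : Matrix V V ℝ) : (Sᵀ * B * S).trace = ∑ i, ∑ j, B i j * ∑ k, S i k * S j k := by
  have hR : (∑ i, ∑ j, B i j * ∑ k, S i k * S j k : ℝ) = ∑ i, ∑ j, ∑ k, S i k * B i j * S j k := by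
    refine sum_congr rfl fun i _ => sum_congr rfl fun j _ => ?_
    rw [mul_sum]
    exact sum_congr rfl fun k _ => by ring
  have hL : (Sᵀ * B * S).trace = ∑ k, ∑ j, ∑ i, S i k * B i j * S j k := by
    simp only [trace, diag_apply, mul_apply, transpose_apply, sum_mul]
  rw [hL, hR]
  calc (∑ k, ∑ j, ∑ i, S i k * B i j * S j k : ℝ)
      = ∑ j, ∑ k, ∑ i, S i k * B i j * S j k := sum_comm
    _ = ∑ j, ∑ i, ∑ k, S i k * B i j * S j k := sum_congr rfl fun j _ => sum_comm
    _ = ∑ i, ∑ j, ∑ k, S i k * B i j * S j k := sum_comm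

/-- **`∑_{ij} ∑_k B_{ij} S_{ik} S_{jk} = Tr(Sᵀ B S)`**, hence `Q = Tr(SᵀBS)/(2m)`.
[cite: Newman2006EigenvectorsPRE, §4.2 eq. (q4)] -/
theorem modularity_eq_trace {α : Type*} [Fintype α] [DecidableEq α] (g : V → α) :
    modularity G g
      = ((indexMatrix g)ᵀ * modularityMatrix G * indexMatrix g).trace / (2 * edgeNum G) := by
  unfold modularity
  congr 1
  have hδ : ∀ i j, (if g i = g j then modularityMatrix G i j else 0)
      = modularityMatrix G i j * ∑ k, indexMatrix g i k * indexMatrix g j k := by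
    intro i j
    rw [← delta_eq_sum_indexMatrix]
    split_ifs <;> simp
  simp_rw [hδ]
  exact (trace_transpose_mul_mul (indexMatrix g) (modularityMatrix G)).symm

/-! ## §6 The spectral bound implicit in eq. (q3) -/

/-- Consequence proved here of eq. (q3) `Q = (1/4m) ∑_i a_i² β_i` with `∑_i a_i² = sᵀs = n`
(not printed as an inequality): for every division into two groups,
`Q ≤ n β₁ / (4m)`, `β₁` the largest eigenvalue of the modularity matrix.
[cite: Newman2006EigenvectorsPRE, §4.1 eq. (q3); Newman2006ModularityPNAS, eq. (3)] -/
theorem modularity_le_card_mul_topEigenvalue [DecidableEq V] [Nonempty V] (hm : 0 < edgeNum G)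
    (g : V → Bool) :
    modularity G g
      ≤ Fintype.card V * topEigenvalue (isHermitian_modularityMatrix G) / (4 * edgeNum G) := by
  rw [modularity_eq_quadForm]
  have h := dotProduct_mulVec_le (isHermitian_modularityMatrix G) (spin g)
  rw [spin_dotProduct_self] at h
  have h4 : 0 < 4 * edgeNum G := by positivity
  rw [div_le_div_iff_of_pos_right h4]
  linarith

end Literature.Combinatorics.SimpleGraph.NewmanModularity
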